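import Literature.MathematicalPhysics.QuantumFieldTheory.Balaban1983to89.B9Eq349KWAssembly

/-!
# `Balaban1983to89.B9Eq387IMSLocShapeAdapter` — T. Bałaban, *Propagators for lattice gauge theories in a background field*, Commun. Math. Phys. **99**
# (1985) 389–434 [Balaban1985BackgroundPropagators] (3.26) p. 395 («Δ_a(U) = Δ(U) + D_U R(U) D*_U + Q*(U)aQ(U)»), p. 414 («DRD* = DD* − DPD*»), (3.21)–(3.23)
# p. 394, (3.8) p. 392, (3.87)–(3.89) p. 409: **THE (loc) SHAPE ADAPTER — kernel 7's non-local letter `W = T†`, `T = D_U(1 − R(U))`, IS `(1 − R(U))D*_U`,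
# and `‖D*_UA‖² − ‖T†A‖² = ‖R(U)D*_UA‖²` EXACTLY (Pythagoras for the orthogonal projection `R(U)`), so a cube estimate in the (3.26) currency
# `γ₁(X + ‖D*_UA‖² + Y) + γ₀n ≤ X + ‖R(U)D*_UA‖² + Y` IS kernel 7's `hloc` shape `… ≤ (X + ‖D*_UA‖² + Y) − ‖T†A‖²` and conversely** — the bridge between
# the (γ)-step of S-P6′ (`B9Eq387CubeLocalisedProjection.cube_form_ge′`, cube forms `re⟪z, Λz⟫ + ‖R″(D†z)‖²`) and the `hloc` binder of the row-L11 files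
# (`B9Eq387IMSAssemblyLattice` ∕ `…SmallField` ∕ `…TierPSmallField`); route R2′ STEP B8′ of the pub-balaban NE9 chain, instance-ledger rows L8 ∕ L10 ∕ L11
# (`t4/ROUTES-NE9.md` v13.30–v13.45)

statement-level skeleton of published theorems with citation tags; proofs where landed; nothing here is a claim about the Yang–Mills mass gap

CITATION HEADER (lean-in-tree rule).  Audit cell `pub-balaban`, sub-cell `t4`, BINDER row NE9; filed by NE9 formalisation-swarm LEAF PROVER 01
(`b2b-balaban-t4-ne9-formalise-leaf-01`, gen 86), over the cell's own objects BY NAME: `B9Eq326OperatorAssembly.RofU` ∕ `RofU_isSymmetric` (the (3.21) orthogonal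
projection at the concrete `Q′(U)`), `B11Eq103H1Complex.projR_projR` (idempotence), `B11Eq103H1Complex.adjoint_covDerivL2K` (`D* = D†` for mutually adjoint
transports), Mathlib's `ContinuousLinearMap.adjoint_inner_left` ∕ `LinearMap.adjoint_inner_left`.  Source READ in the held text [Balaban1985BackgroundPropagators]
(journal page = PDF page + 388): p. 395 (3.26), p. 414 l.5–6 (the `[DRD*, h]` paragraph between (3.100) and (3.101)) *«We have DRD* = DD* − DPD*»*, p. 394 (3.21)–(3.23) («R … the orthogonal projection onto Δ_U N(Q′)»), p. 392
(3.8).  [folklore] Hilbert-space algebra on print's objects; nothing of [B9]'s estimates asserted.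

WHY (rows L10 → L11).  Kernel 7 (`ims_assembly_strong*`) encodes the (3.26) term `‖R(U)D*_UA‖²` as `‖T₂A‖² − ‖WA‖²` with `T₂ = D*_U` (the divergence with the
INVERSE transports `S = R(U(b)⁻¹)`, so that `T₂ = D_U†` by `adjoint_covDerivL2K` under `hRS`) and `W = T†`, `T = D_U(1 − R(U))`.  The (loc) suppliers (S-P4 ∕
S-P6′(β)(γ) ∕ B7′-1) produce cube estimates in the (3.26) currency.  This file shows the two currencies agree identically, so their output feeds `hloc` by
`linarith` with ONE identity — no estimate is spent.

WHAT IS PROVED (sorry-free; proof lane — no `def`; [folklore]).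
* §1 `norm_sq_eq_add_of_symm_idem` — Pythagoras for a symmetric idempotent linear map `P`: `‖v‖² = ‖Pv‖² + ‖v − Pv‖²` (any inner-product space).
* §2 **`adjoint_T_apply`** — at the lattice, under `hRS`: `T†g = D*_Ug − R(U)(D*_Ug)` for `T = toCLM(D_U ∘ (1 − R(U)))`, `D*_U := covDivL2K η⁻¹ (R(U(b)⁻¹))`.
* §3 **`norm_sq_covDiv_sub_norm_sq_adjoint_T`** — `‖D*_UA‖² − ‖T†A‖² = ‖R(U)(D*_UA)‖²`.
* §4 **`loc_shape_of_cubeForm`**, `cubeForm_of_loc_shape` — for any reals `X, Y, n, γ₁, γ₀`: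
  `γ₁(X + ‖D*_UA‖² + Y) + γ₀n ≤ X + ‖R(U)D*_UA‖² + Y  ↔  γ₁(X + ‖D*_UA‖² + Y) + γ₀n ≤ (X + ‖D*_UA‖² + Y) − ‖T†A‖²` (the consumer takes
  `X := ‖D_U(χ_B^zA)‖²`, `Y := ‖√a·Q(U)(χ_B^zA)‖²`, `n := ‖χ_B^zA‖²`, `A := χ_B^zA`).
HONEST SCOPE.  Identities only; no estimate, no window, no number; T₂'s transports must be the inverse transports `R(U(b)⁻¹)` for the identity to apply
(kernel 7's generic `S` is then so instantiated by the consumer).  NOT NE9 (cell pub-balaban: NE9 NOT PRINTED ∕ NOT PROVED; «NE9 ⇐ the named binders»; row WALLED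
ON A MODEL (O-NE9-1; #5 UNRULED); spine PROVED 0∕9; rung (B)+1 on a finite T⁴ — NOT infinite volume, NOT mass gap, NOT BetaPertH, NOT Clay; HONEST DEPENDENCY:
continuum YM on T⁴ ⇐ BetaPertH ∧ nine spine estimates (0/9 proved); BetaPertH ⇐ (D1) ∧ (D4) ∧ CAP+tail; G-an2-4 gates asym, D1 and NE2/3/4).  NEW file
importing `B9Eq349KWAssembly` (for the carriers, `RofU`, the adjoint letters); nothing modified.  Net new unproved facts: 0.
v1.1 (gen 86, DOCFIX only): the locator of the sentence «DRD* = DD* − DPD*» corrected to p. 414 (ne9-leaf-06 g72's M-X71-1); every declaration,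
statement and proof byte-identical to v1 (p374419).
-/

noncomputable section

set_option autoImplicit false

open scoped InnerProductSpace ComplexConjugate

namespace Literature.MathematicalPhysics.QuantumFieldTheory.Balaban1983to89.B9Eq387IMSLocShapeAdapter

open B4Sect5Torus (TSite)
open B9SectCLatticeCarrier (Bond)
open B9Eq311L2Pairing (WL2)
open B9Eq319QprimeTorus (fineP)
open B11Eq103H1Complex (SiteL2K BondL2K covDerivL2K covDivL2K adjoint_covDerivL2K projR_projR)
open B9Eq310HessianOperator (adTransportW)
open B9Eq326OperatorAssembly (RofU RofU_isSymmetric)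

/-! ## §1 Pythagoras for a symmetric idempotent -/

section Abstract

variable {𝕜 : Type*} [RCLike 𝕜] {E : Type*} [NormedAddCommGroup E] [InnerProductSpace 𝕜 E]

/-- **Pythagoras for an orthogonal projection given as a symmetric idempotent linear map**: `‖v‖² = ‖Pv‖² + ‖v − Pv‖²`. [folklore]
[cite: Balaban1985BackgroundPropagators, (3.21) p.394 «orthogonal projection», (3.26) p.395] -/
theorem norm_sq_eq_add_of_symm_idem (P : E →ₗ[𝕜] E) (hP : P.IsSymmetric) (hPP : ∀ v, P (P v) = P v) (v : E) :
    ‖v‖ ^ 2 = ‖P v‖ ^ 2 + ‖v - P v‖ ^ 2 := by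
  have horth : ⟪P v, v - P v⟫_𝕜 = 0 := by
    rw [hP, map_sub, hPP, sub_self, inner_zero_right]
  have h := @norm_add_sq_eq_norm_sq_add_norm_sq_of_inner_eq_zero 𝕜 E _ _ _ (P v) (v - P v) horth
  rw [add_sub_cancel] at h
  simp only [sq]
  exact h

end Abstract

/-! ## §2–§4 At the lattice: `T† = (1 − R(U))D*_U` and the currency identity -/

section Lattice

variable {d : ℕ} (L : ℕ) [NeZero L] (m : Fin d → ℕ)
  {𝔸 : Type*} [NormedRing 𝔸] [NormedAlgebra ℂ 𝔸]
  {W : Type*} [NormedAddCommGroup W] [InnerProductSpace ℂ W] [FiniteDimensional ℂ W] (φ : W ≃ₗ[ℂ] 𝔸)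
  (c₀ : ℝ) [Fact (0 < c₀)] (η : ℝ) (U : Bond d (fineP L m) → 𝔸ˣ)
  (hRS : ∀ (b : Bond d (fineP L m)) (v u : W), ⟪adTransportW φ U b v, u⟫_ℂ = ⟪v, adTransportW φ (fun b => (U b)⁻¹) b u⟫_ℂ)

include hRS in
/-- **`T†g = D*_Ug − R(U)(D*_Ug)`** for `T = toCLM(D_U ∘ (1 − R(U)))`, with `D*_U := covDivL2K η⁻¹ (R(U(b)⁻¹))` (`= D_U†` by `adjoint_covDerivL2K` under `hRS`)
and `R(U)` symmetric — tested against every `x` (`ext_inner_right`). [folklore] [cite: Balaban1985BackgroundPropagators, (3.8) p.392, (3.21) p.394, (3.26) p.395] -/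
theorem adjoint_T_apply (T : SiteL2K ℂ d (fineP L m) c₀ W →L[ℂ] BondL2K ℂ d (fineP L m) c₀ W)
    (hT : T = LinearMap.toContinuousLinearMap
      (covDerivL2K ℂ c₀ ((η : ℂ))⁻¹ (adTransportW φ U) ∘ₗ (LinearMap.id - RofU L m φ η U (c₀ := c₀))))
    (g : BondL2K ℂ d (fineP L m) c₀ W) :
    ContinuousLinearMap.adjoint T g =
      covDivL2K ℂ c₀ ((η : ℂ))⁻¹ (adTransportW φ fun b => (U b)⁻¹) g -
        RofU L m φ η U (c₀ := c₀) (covDivL2K ℂ c₀ ((η : ℂ))⁻¹ (adTransportW φ fun b => (U b)⁻¹) g) := by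
  have hconj : conj ((η : ℂ))⁻¹ = ((η : ℂ))⁻¹ := by rw [map_inv₀, Complex.conj_ofReal]
  have hadj := adjoint_covDerivL2K (c₀ := c₀) ((η : ℂ))⁻¹ hconj (adTransportW φ U) (adTransportW φ fun b => (U b)⁻¹) hRS
  have hsym := RofU_isSymmetric L m φ η U (c₀ := c₀)
  apply ext_inner_right ℂ
  intro x
  rw [ContinuousLinearMap.adjoint_inner_left, hT]
  simp only [LinearMap.coe_toContinuousLinearMap', LinearMap.comp_apply, LinearMap.sub_apply, LinearMap.id_apply]
  rw [← hadj, inner_sub_left, hsym, LinearMap.adjoint_inner_left, LinearMap.adjoint_inner_left, ← inner_sub_right, ← map_sub]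

include hRS in
/-- **THE CURRENCY IDENTITY `‖D*_UA‖² − ‖T†A‖² = ‖R(U)(D*_UA)‖²`** — §2 plus Pythagoras §1 for the symmetric idempotent `R(U)` (`RofU_isSymmetric`,
`projR_projR`). [folklore] [cite: Balaban1985BackgroundPropagators, (3.26) p.395, p.414 «DRD* = DD* − DPD*», (3.21) p.394] -/
theorem norm_sq_covDiv_sub_norm_sq_adjoint_T (T : SiteL2K ℂ d (fineP L m) c₀ W →L[ℂ] BondL2K ℂ d (fineP L m) c₀ W)
    (hT : T = LinearMap.toContinuousLinearMap
      (covDerivL2K ℂ c₀ ((η : ℂ))⁻¹ (adTransportW φ U) ∘ₗ (LinearMap.id - RofU L m φ η U (c₀ := c₀))))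
    (A : BondL2K ℂ d (fineP L m) c₀ W) :
    ‖covDivL2K ℂ c₀ ((η : ℂ))⁻¹ (adTransportW φ fun b => (U b)⁻¹) A‖ ^ 2 - ‖ContinuousLinearMap.adjoint T A‖ ^ 2 =
      ‖RofU L m φ η U (c₀ := c₀) (covDivL2K ℂ c₀ ((η : ℂ))⁻¹ (adTransportW φ fun b => (U b)⁻¹) A)‖ ^ 2 := by
  rw [adjoint_T_apply L m φ c₀ η U hRS T hT A]
  have h := norm_sq_eq_add_of_symm_idem (RofU L m φ η U (c₀ := c₀)) (RofU_isSymmetric L m φ η U (c₀ := c₀))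
    (fun v => projR_projR _ _ v) (covDivL2K ℂ c₀ ((η : ℂ))⁻¹ (adTransportW φ fun b => (U b)⁻¹) A)
  linarith

include hRS in
/-- **(loc) IN KERNEL 7's SHAPE FROM A CUBE ESTIMATE IN THE (3.26) CURRENCY**: for any reals `X, Y, n, γ₁, γ₀`,
`γ₁(X + ‖D*_UA‖² + Y) + γ₀n ≤ X + ‖R(U)D*_UA‖² + Y` ⟹ `γ₁(X + ‖D*_UA‖² + Y) + γ₀n ≤ (X + ‖D*_UA‖² + Y) − ‖T†A‖²`. [folklore]
[cite: Balaban1985BackgroundPropagators, (3.26) p.395, (3.87)–(3.89) p.409] -/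
theorem loc_shape_of_cubeForm (T : SiteL2K ℂ d (fineP L m) c₀ W →L[ℂ] BondL2K ℂ d (fineP L m) c₀ W)
    (hT : T = LinearMap.toContinuousLinearMap
      (covDerivL2K ℂ c₀ ((η : ℂ))⁻¹ (adTransportW φ U) ∘ₗ (LinearMap.id - RofU L m φ η U (c₀ := c₀))))
    {X Y n γ₁ γ₀ : ℝ} (A : BondL2K ℂ d (fineP L m) c₀ W)
    (h : γ₁ * (X + ‖covDivL2K ℂ c₀ ((η : ℂ))⁻¹ (adTransportW φ fun b => (U b)⁻¹) A‖ ^ 2 + Y) + γ₀ * n ≤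
      X + ‖RofU L m φ η U (c₀ := c₀) (covDivL2K ℂ c₀ ((η : ℂ))⁻¹ (adTransportW φ fun b => (U b)⁻¹) A)‖ ^ 2 + Y) :
    γ₁ * (X + ‖covDivL2K ℂ c₀ ((η : ℂ))⁻¹ (adTransportW φ fun b => (U b)⁻¹) A‖ ^ 2 + Y) + γ₀ * n ≤
      (X + ‖covDivL2K ℂ c₀ ((η : ℂ))⁻¹ (adTransportW φ fun b => (U b)⁻¹) A‖ ^ 2 + Y) - ‖ContinuousLinearMap.adjoint T A‖ ^ 2 := by
  have hid := norm_sq_covDiv_sub_norm_sq_adjoint_T L m φ c₀ η U hRS T hT A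
  linarith

include hRS in
/-- The converse direction: kernel 7's `hloc` shape gives back the cube estimate in the (3.26) currency. [folklore]
[cite: Balaban1985BackgroundPropagators, (3.26) p.395, (3.87)–(3.89) p.409] -/
theorem cubeForm_of_loc_shape (T : SiteL2K ℂ d (fineP L m) c₀ W →L[ℂ] BondL2K ℂ d (fineP L m) c₀ W)
    (hT : T = LinearMap.toContinuousLinearMap
      (covDerivL2K ℂ c₀ ((η : ℂ))⁻¹ (adTransportW φ U) ∘ₗ (LinearMap.id - RofU L m φ η U (c₀ := c₀))))
    {X Y n γ₁ γ₀ : ℝ} (A : BondL2K ℂ d (fineP L m) c₀ W)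
    (h : γ₁ * (X + ‖covDivL2K ℂ c₀ ((η : ℂ))⁻¹ (adTransportW φ fun b => (U b)⁻¹) A‖ ^ 2 + Y) + γ₀ * n ≤
      (X + ‖covDivL2K ℂ c₀ ((η : ℂ))⁻¹ (adTransportW φ fun b => (U b)⁻¹) A‖ ^ 2 + Y) - ‖ContinuousLinearMap.adjoint T A‖ ^ 2) :
    γ₁ * (X + ‖covDivL2K ℂ c₀ ((η : ℂ))⁻¹ (adTransportW φ fun b => (U b)⁻¹) A‖ ^ 2 + Y) + γ₀ * n ≤
      X + ‖RofU L m φ η U (c₀ := c₀) (covDivL2K ℂ c₀ ((η : ℂ))⁻¹ (adTransportW φ fun b => (U b)⁻¹) A)‖ ^ 2 + Y := by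
  have hid := norm_sq_covDiv_sub_norm_sq_adjoint_T L m φ c₀ η U hRS T hT A
  linarith

end Lattice

end Literature.MathematicalPhysics.QuantumFieldTheory.Balaban1983to89.B9Eq387IMSLocShapeAdapter

end
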